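import Summits.Ventures.Crystal3D.Theorems.StickyWulffConstantNoReconstructionGainGrainToucher
import Summits.Ventures.Crystal3D.Theorems.StickyWulffConstantNoReconstructionGainGrainSchedule
import Summits.Ventures.Crystal3D.Theorems.StickyWulffConstantNoReconstructionGainGrainOrientation
import Summits.Ventures.Crystal3D.Theorems.StickyWulffConstantNoReconstructionGainGrainCross
import HarnessLib

/-!
# The adhesion atom at `(111)` for misoriented Barlow grains

HONEST FRAMING. Part of the venture `Summits/Ventures/Crystal3D` (cell `crystal3d-full`), helper
`--supports` the crux `NoReconstructionGain` (stmt-Ventures-19144, route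
`route-Ventures-StickyWulffConstant`), line `adhesion` (lead crystal3d-wulff-p1).  GRAIN RUNG of
the registered atom `stub_adhesion` at the normal `ν = e₃`: the "other grains" clause of the crux.

**Theorem** (`barlowGrainAdhesion111`, `R = 4`, `C = 1020 π`).  For `ρ ≥ R`, every finite unit
packing `X ⊇ P`, `P` = the fcc `(111)` slab sample (all sites of `fccStacking 1 √(2/3)` with
`−2R ≤ ⟪p, e₃⟫ ≤ −R` and `‖p‖² − ⟪p, e₃⟫² ≤ ρ²`), such that the non-sample balls `X \ P` are
contained in ONE rigid-motion image `A(·) + t` of SOME Barlow stacking `barlowStacking 1 √(2/3) σ`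
(any Hägg word `σ` — fcc, hcp, any polytype, twinned lamellae —, any linear isometry `A`, any
translation `t`, any SUBSET of the grain: porous, islands, films of any thickness and tilt):
`#{(p, q) ∈ P × (X \ P) : dist p q = 1} ≤ contactDeficiency (X \ P) + C ρ`.
The constant is uniform in the grain and its orientation.

**Proof** (non-local; "payment flows through the grain").  A ball `q` of the grain touching a
CORE site of the sample (lateral radius `≤ ρ − 3`) lies in the toucher band of thickness
`1 − h < 19/100` above the top face or below the bottom face (`h = √(2/3)`; hollow positions are
the lowest, `…GrainGeom`) and touches at most three sample sites (cone lemma).  The contact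
deficiency of the grain `Q = X \ P` equals the number of maximal segments of `Q` along the six
transport families of its stacking (three in-layer line families, three interlayer chain
families; `sum_card_adj_add`, `…GrainFamilies`).  For every orientation at least three of these
families climb (or descend) by more than `19/100` per step (`orientation_cases`,
`…GrainOrientation`; the schedule of chain offsets is chosen per Hägg letter, `exists_schedule`);
along such a family two touchers never share a segment and the segment through a toucher cannot
be continued past it into the forbidden region (`…GrainToucher`), so each steep family has at least
as many segments as there are touchers.  Hence `D(Q) ≥ 3 · #touchers ≥ cross − 12 · #rim`, and the
width-three rim has `≤ 85 π ρ` sites (`…GrainRim`).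

Relation to earlier rungs: tilted grains contain `12`-coordinated balls with oblique bonds and
violate the pointwise flat-profile rule (`F = 13` on alternate layers of tilted hcp), so they are
outside `lowCoordAdhesion111_nine`, `steepFlatAdhesion111` and `adhesion111_of_localSteepBalance`;
in-registry Barlow films (`A = 1`) are the case treated by `latticeNoGain` / `…SteepFlatNoGain`.

WHAT THIS IS NOT: the atom for overlayers meeting two different grains, grains plus off-site
adatoms, or amorphous films; other facets `ν ≠ e₃`; rung F-C1 not moved.
-/

noncomputable section

namespace Summit.Ventures.Crystal3D.Theorems

open Summit.Ventures.Crystal3D Finset Real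
open Literature.MathematicalPhysics.StatisticalMechanics (barlowPos barlowStacking fccStacking
  IsHaggSeq constHagg threeOffsets barlowPos_apply_two orderedContacts contactDeficiency
  le_dist_barlowPos_of_ideal)
open scoped InnerProductSpace

/-- **The adhesion atom at `(111)` for Barlow grains of arbitrary orientation.**  With `R = 4`,
`C = 1020 π`: for `ρ ≥ R`, every finite unit packing `X ⊇ P`, `P` the fcc `(111)` slab sample,
whose non-sample part `X \ P` is contained in a rigid-motion image of a Barlow stacking
(`(fun p => A p + t) '' barlowStacking 1 √(2/3) σ`, `σ` a Hägg sequence, `A` a linear isometry):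
`#{(p, q) ∈ P × (X \ P) : dist p q = 1} ≤ contactDeficiency (X \ P) + C ρ`. -/
theorem barlowGrainAdhesion111 :
    ∃ R C : ℝ, 1 ≤ R ∧ ∀ ρ : ℝ, R ≤ ρ → ∀ X P : Finset (EuclideanSpace ℝ (Fin 3)),
      (∀ p ∈ X, ∀ q ∈ X, p ≠ q → 1 ≤ dist p q) → P ⊆ X →
      (∀ p, p ∈ P ↔ (p ∈ fccStacking 1 (Real.sqrt (2 / 3)) ∧
        -(2 * R) ≤ ⟪p, EuclideanSpace.single (2 : Fin 3) (1 : ℝ)⟫_ℝ ∧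
        ⟪p, EuclideanSpace.single (2 : Fin 3) (1 : ℝ)⟫_ℝ ≤ -R ∧
        ‖p‖ ^ 2 - ⟪p, EuclideanSpace.single (2 : Fin 3) (1 : ℝ)⟫_ℝ ^ 2 ≤ ρ ^ 2)) →
      (∃ (A : EuclideanSpace ℝ (Fin 3) ≃ₗᵢ[ℝ] EuclideanSpace ℝ (Fin 3))
          (t : EuclideanSpace ℝ (Fin 3)) (σ : ℤ → ℤ), IsHaggSeq σ ∧
          (↑(X \ P) : Set (EuclideanSpace ℝ (Fin 3))) ⊆
            (fun p => A p + t) '' barlowStacking 1 (Real.sqrt (2 / 3)) σ) →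
      ((((P ×ˢ (X \ P)).filter fun pq => dist pq.1 pq.2 = 1).card : ℕ) : ℝ) ≤
        contactDeficiency (X \ P) + C * ρ := by
  classical
  refine ⟨4, 1020 * Real.pi, by norm_num, ?_⟩
  intro ρ hρ X P hX hPX hP hgrain
  obtain ⟨hh2, hh45, hh89⟩ := sqrt_two_thirds_bounds
  have hgt := sqrt_two_thirds_gt
  set h : ℝ := Real.sqrt (2 / 3) with hhdef
  have hhpos : 0 < h := by linarith
  have hh' : h ^ 2 = 2 / 3 * (1 : ℝ) ^ 2 := by rw [hh2]; ring
  -- the sample in coordinates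
  have hinner : ∀ p : EuclideanSpace ℝ (Fin 3),
      ⟪p, EuclideanSpace.single (2 : Fin 3) (1 : ℝ)⟫_ℝ = p 2 :=
    fun p => by simp [EuclideanSpace.inner_single_right]
  have hlat : ∀ p : EuclideanSpace ℝ (Fin 3), ‖p‖ ^ 2 - (p 2) ^ 2 = p 0 ^ 2 + p 1 ^ 2 := fun p => by
    rw [EuclideanSpace.real_norm_sq_eq, Fin.sum_univ_three]; ring
  have hP' : ∀ p, p ∈ P ↔ (p ∈ fccStacking 1 (Real.sqrt (2 / 3)) ∧ -8 ≤ p 2 ∧ p 2 ≤ -4 ∧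
      p 0 ^ 2 + p 1 ^ 2 ≤ ρ ^ 2) := by
    intro p
    rw [hP p, hinner, hlat]
    constructor
    · rintro ⟨a, b, c, d⟩; exact ⟨a, by linarith, by linarith, d⟩
    · rintro ⟨a, b, c, d⟩; exact ⟨a, by linarith, by linarith, d⟩
  set Q := X \ P with hQ
  have hQX : ∀ q ∈ Q, q ∈ X ∧ q ∉ P := fun q hq => mem_sdiff.1 hq
  obtain ⟨A, t, σ, hσ, hsub⟩ := hgrain
  /- ### 1. The grain in coordinates -/
  set pos : ℤ × ℤ × ℤ → EuclideanSpace ℝ (Fin 3) := fun z => barlowPos 1 h σ z.1 z.2.1 z.2.2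
    with hposdef
  set gp : ℤ × ℤ × ℤ → EuclideanSpace ℝ (Fin 3) := fun z => A (pos z) + t with hgpdef
  have hgp_dist : ∀ z w, dist (gp z) (gp w) = dist (pos z) (pos w) := by
    intro z w; simp only [hgpdef]; rw [dist_add_right, LinearIsometryEquiv.dist_map]
  have hgp_inj : Function.Injective gp := by
    intro z w hzw
    by_contra hne
    have hne' : (z.1, z.2.1, z.2.2) ≠ (w.1, w.2.1, w.2.2) := by
      intro h0
      apply hne
      simp only [Prod.mk.injEq] at h0
      exact Prod.ext h0.1 (Prod.ext h0.2.1 h0.2.2)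
    have h1 := le_dist_barlowPos_of_ideal hσ one_pos hh' hne'
    have h0 : dist (gp z) (gp w) = 0 := by rw [hzw, dist_self]
    rw [hgp_dist] at h0
    simp only [hposdef] at h0
    linarith
  -- every ball of `Q` is a grain site
  have hrange : ∀ q ∈ Q, ∃ z, gp z = q := by
    intro q hq
    obtain ⟨p, ⟨k, i, j, rfl⟩, hp⟩ := hsub (mem_coe.2 hq)
    exact ⟨(k, i, j), hp⟩
  set Q' : Finset (ℤ × ℤ × ℤ) := Q.preimage gp hgp_inj.injOn with hQ'def
  have hmemQ' : ∀ z, z ∈ Q' ↔ gp z ∈ Q := fun z => by rw [hQ'def, mem_preimage]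
  have hQ'img : Q'.image gp = Q := by
    rw [hQ'def, image_preimage]
    refine filter_true_of_mem fun q hq => ?_
    obtain ⟨z, hz⟩ := hrange q hq
    exact ⟨z, hz⟩
  have hQ'card : Q'.card = Q.card := by rw [← hQ'img, card_image_of_injective _ hgp_inj]
  have hQ'Q : ∀ z ∈ Q', gp z ∈ X \ P := fun z hz => (hmemQ' z).1 hz
  /- ### 2. Ordered contacts of `Q` as the degree sum over sites -/
  have hoc : (orderedContacts Q : ℝ) = ∑ z ∈ Q', ((Q'.filter fun w =>
      dist (pos z) (pos w) = 1).card : ℝ) := by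
    rw [orderedContacts_eq_sum_sum, ← hQ'img, sum_image fun z _ w _ hzw => hgp_inj hzw]
    refine sum_congr rfl fun z _ => ?_
    rw [sum_image fun z _ w _ hzw => hgp_inj hzw]
    have : ∀ w ∈ Q', (if dist (gp z) (gp w) = 1 then (1 : ℝ) else 0) =
        (if dist (pos z) (pos w) = 1 then (1 : ℝ) else 0) := fun w _ => by rw [hgp_dist]
    rw [sum_congr rfl this, Finset.sum_boole]
  -- the deficiency of `Q` is the total number of segments, for every schedule
  have hD : ∀ off : Fin 3 → ℤ → ℤ × ℤ, (∀ m k, off m k ∈ threeOffsets (-σ k)) →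
      (∀ k, Function.Injective fun m => off m k) →
      contactDeficiency Q = ((Q'.filter fun z => (z.1, z.2.1 + 1, z.2.2) ∉ Q').card : ℝ) +
        ((Q'.filter fun z => (z.1, z.2.1, z.2.2 + 1) ∉ Q').card : ℝ) +
        ((Q'.filter fun z => (z.1, z.2.1 + 1, z.2.2 - 1) ∉ Q').card : ℝ) +
        ∑ m : Fin 3, ((Q'.filter fun z =>
          (z.1 + 1, z.2.1 - (off m z.1).1, z.2.2 - (off m z.1).2) ∉ Q').card : ℝ) := by
    intro off hmem hinj
    have hid := sum_card_adj_add hσ off hmem hinj Q'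
    have hid' : (∑ z ∈ Q', ((Q'.filter fun w => dist (pos z) (pos w) = 1).card : ℝ)) +
        2 * (((Q'.filter fun z => (z.1, z.2.1 + 1, z.2.2) ∉ Q').card : ℝ) +
          ((Q'.filter fun z => (z.1, z.2.1, z.2.2 + 1) ∉ Q').card : ℝ) +
          ((Q'.filter fun z => (z.1, z.2.1 + 1, z.2.2 - 1) ∉ Q').card : ℝ) +
          ∑ m : Fin 3, ((Q'.filter fun z =>
            (z.1 + 1, z.2.1 - (off m z.1).1, z.2.2 - (off m z.1).2) ∉ Q').card : ℝ)) =
        12 * (Q'.card : ℝ) := by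
      simp only [hposdef]
      exact_mod_cast hid
    unfold contactDeficiency
    rw [hoc, ← hQ'card]
    linarith
  /- ### 3. The direction `ν'` and the heights -/
  set e₃ : EuclideanSpace ℝ (Fin 3) := EuclideanSpace.single (2 : Fin 3) (1 : ℝ) with he₃
  set ν' : EuclideanSpace ℝ (Fin 3) := A.symm e₃ with hν'
  have hν'norm : ν' 0 ^ 2 + ν' 1 ^ 2 + ν' 2 ^ 2 = 1 := by
    have h1 : ‖ν'‖ = 1 := by
      rw [hν', LinearIsometryEquiv.norm_map, he₃]; simp
    have h2 := EuclideanSpace.real_norm_sq_eq ν'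
    rw [h1, Fin.sum_univ_three] at h2
    nlinarith [h2]
  have hht : ∀ z, (gp z) 2 = ⟪pos z, ν'⟫_ℝ + t 2 := by
    intro z
    simp only [hgpdef, PiLp.add_apply]
    congr 1
    rw [← hinner, ← LinearIsometryEquiv.inner_map_map A (pos z) ν', hν',
      LinearIsometryEquiv.apply_symm_apply]
  have hslope : ∀ z w, (gp w) 2 - (gp z) 2 = ⟪pos w - pos z, ν'⟫_ℝ := by
    intro z w; rw [hht, hht, inner_sub_left]; ring
  /- ### 4. Touchers of core sites (substrate side) -/
  obtain ⟨Ta, Tb, hTaQ, hTbQ, hTa_band, hTb_band, hcross⟩ :=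
    cross_le_touchers ρ hρ X P hX hPX hP'
  set Ta' : Finset (ℤ × ℤ × ℤ) := Ta.preimage gp hgp_inj.injOn with hTa'
  set Tb' : Finset (ℤ × ℤ × ℤ) := Tb.preimage gp hgp_inj.injOn with hTb'
  have hpre_card : ∀ (S : Finset (EuclideanSpace ℝ (Fin 3))) (hS : S ⊆ Q),
      (S.preimage gp hgp_inj.injOn).card = S.card := by
    intro S hS
    have himg : (S.preimage gp hgp_inj.injOn).image gp = S := by
      rw [image_preimage]
      refine filter_true_of_mem fun q hq => ?_
      obtain ⟨z, hz⟩ := hrange q (hS hq)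
      exact ⟨z, hz⟩
    rw [← card_image_of_injective _ hgp_inj, himg]
  have hTa'card : Ta'.card = Ta.card := hpre_card Ta hTaQ
  have hTb'card : Tb'.card = Tb.card := hpre_card Tb hTbQ
  have hTa'Q : Ta' ⊆ Q' := fun z hz => (hmemQ' z).2 (hTaQ (mem_preimage.1 hz))
  have hTb'Q : Tb' ⊆ Q' := fun z hz => (hmemQ' z).2 (hTbQ (mem_preimage.1 hz))
  have hTa'band : ∀ z ∈ Ta', -(4 * Real.sqrt (2 / 3)) ≤ (gp z) 2 ∧
      (gp z) 2 ≤ -(5 * Real.sqrt (2 / 3)) + 1 ∧ (gp z) 0 ^ 2 + (gp z) 1 ^ 2 ≤ (ρ - 2) ^ 2 :=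
    fun z hz => hTa_band _ (mem_preimage.1 hz)
  have hTb'band : ∀ z ∈ Tb', -(9 * Real.sqrt (2 / 3)) - 1 ≤ (gp z) 2 ∧
      (gp z) 2 ≤ -(10 * Real.sqrt (2 / 3)) ∧ (gp z) 0 ^ 2 + (gp z) 1 ^ 2 ≤ (ρ - 2) ^ 2 :=
    fun z hz => hTb_band _ (mem_preimage.1 hz)
  /- ### 6. Steep families pay one unit per toucher -/
  set N : ℕ := Ta'.card + Tb'.card with hN
  -- in-layer families: slope `s`, step `T`
  have hbasal : ∀ (T : ℤ × ℤ × ℤ → ℤ × ℤ × ℤ) (s : ℝ), Function.Injective T →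
      (∀ z, dist (pos (T z)) (pos z) = 1) → (∀ z, ⟪pos (T z) - pos z, ν'⟫_ℝ = s) →
      (19 / 100 < s ∨ s < -(19 / 100)) → N ≤ (Q'.filter fun z => T z ∉ Q').card := by
    intro T s hTinj hTd hTs hs
    have hadj : ∀ z, dist (gp (T z)) (gp z) ≤ 1 := fun z => by rw [hgp_dist, hTd]
    rcases hs with hs | hs
    · exact card_touchers_le_seg_of_up ρ hρ X P hX hPX hP' gp Q' hQ'Q T hTinj hadj
        (fun z => by have := hslope z (T z); rw [hTs] at this; linarith) Ta' Tb' hTa'Q hTb'Q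
        hTa'band hTb'band
    · exact card_touchers_le_seg_of_down ρ hρ X P hX hPX hP' gp Q' hQ'Q T hTinj hadj
        (fun z => by have := hslope z (T z); rw [hTs] at this; linarith) Ta' Tb' hTa'Q hTb'Q
        hTa'band hTb'band
  -- chain families: slope depends on the layer through the letter and the scheduled offset
  have hchain : ∀ (off : Fin 3 → ℤ → ℤ × ℤ), (∀ m k, off m k ∈ threeOffsets (-σ k)) →
      ∀ m : Fin 3,
      ((∀ k, 19 / 100 < -((off m k).1 : ℝ) * ν' 0 - ((off m k).2 : ℝ) * (ν' 0 / 2 +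
          Real.sqrt 3 / 2 * ν' 1) + (σ k : ℝ) * (ν' 0 / 2 + Real.sqrt 3 / 6 * ν' 1) +
          Real.sqrt (2 / 3) * ν' 2) ∨
       (∀ k, -((off m k).1 : ℝ) * ν' 0 - ((off m k).2 : ℝ) * (ν' 0 / 2 +
          Real.sqrt 3 / 2 * ν' 1) + (σ k : ℝ) * (ν' 0 / 2 + Real.sqrt 3 / 6 * ν' 1) +
          Real.sqrt (2 / 3) * ν' 2 < -(19 / 100))) →
      N ≤ (Q'.filter fun z => (z.1 + 1, z.2.1 - (off m z.1).1, z.2.2 - (off m z.1).2) ∉ Q').card := by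
    intro off hmem m hm
    set T : ℤ × ℤ × ℤ → ℤ × ℤ × ℤ := fun z =>
      (z.1 + 1, z.2.1 - (off m z.1).1, z.2.2 - (off m z.1).2) with hT
    have hTinj : Function.Injective T := by
      intro z w hzw
      simp only [hT, Prod.mk.injEq] at hzw
      obtain ⟨h1, h2, h3⟩ := hzw
      have hk : z.1 = w.1 := by omega
      rw [hk] at h2 h3
      exact Prod.ext hk (Prod.ext (by omega) (by omega))
    have hTd : ∀ z, dist (pos (T z)) (pos z) = 1 := fun z => by
      simp only [hposdef, hT]; exact dist_step_chain hσ z.1 z.2.1 z.2.2 (hmem m z.1)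
    have hTs : ∀ z, ⟪pos (T z) - pos z, ν'⟫_ℝ = -((off m z.1).1 : ℝ) * ν' 0 -
        ((off m z.1).2 : ℝ) * (ν' 0 / 2 + Real.sqrt 3 / 2 * ν' 1) +
        (σ z.1 : ℝ) * (ν' 0 / 2 + Real.sqrt 3 / 6 * ν' 1) + Real.sqrt (2 / 3) * ν' 2 := fun z => by
      simp only [hposdef, hT]; exact inner_step_chain σ ν' z.1 z.2.1 z.2.2 _ _
    have hadj : ∀ z, dist (gp (T z)) (gp z) ≤ 1 := fun z => by rw [hgp_dist, hTd]
    rcases hm with hm | hm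
    · exact card_touchers_le_seg_of_up ρ hρ X P hX hPX hP' gp Q' hQ'Q T hTinj hadj
        (fun z => by have := hslope z (T z); rw [hTs] at this; linarith [hm z.1]) Ta' Tb'
        hTa'Q hTb'Q hTa'band hTb'band
    · exact card_touchers_le_seg_of_down ρ hρ X P hX hPX hP' gp Q' hQ'Q T hTinj hadj
        (fun z => by have := hslope z (T z); rw [hTs] at this; linarith [hm z.1]) Ta' Tb'
        hTa'Q hTb'Q hTa'band hTb'band
  -- the three in-layer families, concretely
  have hB₁ : (19 / 100 < ν' 0 ∨ ν' 0 < -(19 / 100)) →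
      N ≤ (Q'.filter fun z => (z.1, z.2.1 + 1, z.2.2) ∉ Q').card := fun hs =>
    hbasal (fun z => (z.1, z.2.1 + 1, z.2.2)) (ν' 0)
      (fun z w hzw => by
        simp only [Prod.mk.injEq] at hzw
        exact Prod.ext hzw.1 (Prod.ext (by omega) hzw.2.2))
      (fun z => by simp only [hposdef]; exact dist_step_basal₁ hσ z.1 z.2.1 z.2.2)
      (fun z => by simp only [hposdef]; exact inner_step_basal₁ σ ν' z.1 z.2.1 z.2.2) hs
  have hB₂ : (19 / 100 < ν' 0 / 2 + Real.sqrt 3 / 2 * ν' 1 ∨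
      ν' 0 / 2 + Real.sqrt 3 / 2 * ν' 1 < -(19 / 100)) →
      N ≤ (Q'.filter fun z => (z.1, z.2.1, z.2.2 + 1) ∉ Q').card := fun hs =>
    hbasal (fun z => (z.1, z.2.1, z.2.2 + 1)) _
      (fun z w hzw => by
        simp only [Prod.mk.injEq] at hzw
        exact Prod.ext hzw.1 (Prod.ext hzw.2.1 (by omega)))
      (fun z => by simp only [hposdef]; exact dist_step_basal₂ hσ z.1 z.2.1 z.2.2)
      (fun z => by simp only [hposdef]; exact inner_step_basal₂ σ ν' z.1 z.2.1 z.2.2) hs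
  have hB₃ : (19 / 100 < ν' 0 / 2 - Real.sqrt 3 / 2 * ν' 1 ∨
      ν' 0 / 2 - Real.sqrt 3 / 2 * ν' 1 < -(19 / 100)) →
      N ≤ (Q'.filter fun z => (z.1, z.2.1 + 1, z.2.2 - 1) ∉ Q').card := fun hs =>
    hbasal (fun z => (z.1, z.2.1 + 1, z.2.2 - 1)) _
      (fun z w hzw => by
        simp only [Prod.mk.injEq] at hzw
        exact Prod.ext hzw.1 (Prod.ext (by omega) (by omega)))
      (fun z => by simp only [hposdef]; exact dist_step_basal₃ hσ z.1 z.2.1 z.2.2)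
      (fun z => by simp only [hposdef]; exact inner_step_basal₃ σ ν' z.1 z.2.1 z.2.2) hs
  /- ### 7. Three steep families in every orientation -/
  have hmain : 3 * (N : ℝ) ≤ contactDeficiency Q := by
    have hcases := orientation_cases (ν' 0) (ν' 1) (ν' 2) hν'norm
    -- a schedule with a prescribed first family
    have sched : ∀ c : ℤ → ℤ × ℤ, (∀ s : ℤ, s = 1 ∨ s = -1 → c s ∈ threeOffsets (-s)) →
        ∃ off : Fin 3 → ℤ → ℤ × ℤ, (∀ k, off 0 k = c (σ k)) ∧
          (∀ m k, off m k ∈ threeOffsets (-σ k)) ∧ (∀ k, Function.Injective fun m => off m k) :=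
      fun c hc => exists_schedule hσ c hc
    have hnn : ∀ (S : Finset (ℤ × ℤ × ℤ)), (0 : ℝ) ≤ (S.card : ℝ) := fun S => Nat.cast_nonneg _
    rcases hcases with hI | hIV | ⟨hTwo, hUp⟩ | ⟨hTwo, hDn⟩
    · -- (I) all chain families climb
      obtain ⟨off, -, hmem, hinj⟩ := sched (fun _ => (0, 0))
        (fun s hs => (mem_threeOffsets_neg_of hs).1)
      rw [hD off hmem hinj]
      have h0 := hchain off hmem 0 (Or.inl fun k => hI (σ k) (hσ k) _ (hmem 0 k))
      have h1 := hchain off hmem 1 (Or.inl fun k => hI (σ k) (hσ k) _ (hmem 1 k))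
      have h2 := hchain off hmem 2 (Or.inl fun k => hI (σ k) (hσ k) _ (hmem 2 k))
      have h0' : (N : ℝ) ≤ _ := Nat.cast_le.2 h0
      have h1' : (N : ℝ) ≤ _ := Nat.cast_le.2 h1
      have h2' : (N : ℝ) ≤ _ := Nat.cast_le.2 h2
      rw [Fin.sum_univ_three]
      linarith [hnn (Q'.filter fun z => (z.1, z.2.1 + 1, z.2.2) ∉ Q'),
        hnn (Q'.filter fun z => (z.1, z.2.1, z.2.2 + 1) ∉ Q'),
        hnn (Q'.filter fun z => (z.1, z.2.1 + 1, z.2.2 - 1) ∉ Q')]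
    · -- (IV) all chain families descend
      obtain ⟨off, -, hmem, hinj⟩ := sched (fun _ => (0, 0))
        (fun s hs => (mem_threeOffsets_neg_of hs).1)
      rw [hD off hmem hinj]
      have h0 := hchain off hmem 0 (Or.inr fun k => hIV (σ k) (hσ k) _ (hmem 0 k))
      have h1 := hchain off hmem 1 (Or.inr fun k => hIV (σ k) (hσ k) _ (hmem 1 k))
      have h2 := hchain off hmem 2 (Or.inr fun k => hIV (σ k) (hσ k) _ (hmem 2 k))
      have h0' : (N : ℝ) ≤ _ := Nat.cast_le.2 h0
      have h1' : (N : ℝ) ≤ _ := Nat.cast_le.2 h1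
      have h2' : (N : ℝ) ≤ _ := Nat.cast_le.2 h2
      rw [Fin.sum_univ_three]
      linarith [hnn (Q'.filter fun z => (z.1, z.2.1 + 1, z.2.2) ∉ Q'),
        hnn (Q'.filter fun z => (z.1, z.2.1, z.2.2 + 1) ∉ Q'),
        hnn (Q'.filter fun z => (z.1, z.2.1 + 1, z.2.2 - 1) ∉ Q')]
    · -- (II) two in-layer families and one climbing chain family
      obtain ⟨c₁, hc₁, hc₁'⟩ := hUp 1 (Or.inl rfl)
      obtain ⟨c₂, hc₂, hc₂'⟩ := hUp (-1) (Or.inr rfl)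
      obtain ⟨off, hoff0, hmem, hinj⟩ := sched (fun s => if s = 1 then c₁ else c₂)
        (fun s hs => by
          rcases hs with rfl | rfl
          · simpa using hc₁
          · simpa using hc₂)
      rw [hD off hmem hinj]
      have h0 := hchain off hmem 0 (Or.inl fun k => by
        have e : off 0 k = (fun s : ℤ => if s = 1 then c₁ else c₂) (σ k) := hoff0 k
        rcases hσ k with hk | hk
        · have e' : off 0 k = c₁ := by rw [e]; exact if_pos hk
          rw [e', hk]; exact hc₁'
        · have e' : off 0 k = c₂ := by rw [e]; exact if_neg (by rw [hk]; decide)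
          rw [e', hk]; exact hc₂')
      have h0' : (N : ℝ) ≤ _ := Nat.cast_le.2 h0
      rw [Fin.sum_univ_three]
      have hnn1 := hnn (Q'.filter fun z =>
        (z.1 + 1, z.2.1 - (off 1 z.1).1, z.2.2 - (off 1 z.1).2) ∉ Q')
      have hnn2 := hnn (Q'.filter fun z =>
        (z.1 + 1, z.2.1 - (off 2 z.1).1, z.2.2 - (off 2 z.1).2) ∉ Q')
      rcases hTwo with ⟨hs₁, hs₂⟩ | ⟨hs₁, hs₃⟩ | ⟨hs₂, hs₃⟩
      · have e1 : (N : ℝ) ≤ _ := Nat.cast_le.2 (hB₁ hs₁)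
        have e2 : (N : ℝ) ≤ _ := Nat.cast_le.2 (hB₂ hs₂)
        linarith [hnn (Q'.filter fun z => (z.1, z.2.1 + 1, z.2.2 - 1) ∉ Q')]
      · have e1 : (N : ℝ) ≤ _ := Nat.cast_le.2 (hB₁ hs₁)
        have e3 : (N : ℝ) ≤ _ := Nat.cast_le.2 (hB₃ hs₃)
        linarith [hnn (Q'.filter fun z => (z.1, z.2.1, z.2.2 + 1) ∉ Q')]
      · have e2 : (N : ℝ) ≤ _ := Nat.cast_le.2 (hB₂ hs₂)
        have e3 : (N : ℝ) ≤ _ := Nat.cast_le.2 (hB₃ hs₃)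
        linarith [hnn (Q'.filter fun z => (z.1, z.2.1 + 1, z.2.2) ∉ Q')]
    · -- (III) two in-layer families and one descending chain family
      obtain ⟨c₁, hc₁, hc₁'⟩ := hDn 1 (Or.inl rfl)
      obtain ⟨c₂, hc₂, hc₂'⟩ := hDn (-1) (Or.inr rfl)
      obtain ⟨off, hoff0, hmem, hinj⟩ := sched (fun s => if s = 1 then c₁ else c₂)
        (fun s hs => by
          rcases hs with rfl | rfl
          · simpa using hc₁
          · simpa using hc₂)
      rw [hD off hmem hinj]
      have h0 := hchain off hmem 0 (Or.inr fun k => by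
        have e : off 0 k = (fun s : ℤ => if s = 1 then c₁ else c₂) (σ k) := hoff0 k
        rcases hσ k with hk | hk
        · have e' : off 0 k = c₁ := by rw [e]; exact if_pos hk
          rw [e', hk]; exact hc₁'
        · have e' : off 0 k = c₂ := by rw [e]; exact if_neg (by rw [hk]; decide)
          rw [e', hk]; exact hc₂')
      have h0' : (N : ℝ) ≤ _ := Nat.cast_le.2 h0
      rw [Fin.sum_univ_three]
      have hnn1 := hnn (Q'.filter fun z =>
        (z.1 + 1, z.2.1 - (off 1 z.1).1, z.2.2 - (off 1 z.1).2) ∉ Q')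
      have hnn2 := hnn (Q'.filter fun z =>
        (z.1 + 1, z.2.1 - (off 2 z.1).1, z.2.2 - (off 2 z.1).2) ∉ Q')
      rcases hTwo with ⟨hs₁, hs₂⟩ | ⟨hs₁, hs₃⟩ | ⟨hs₂, hs₃⟩
      · have e1 : (N : ℝ) ≤ _ := Nat.cast_le.2 (hB₁ hs₁)
        have e2 : (N : ℝ) ≤ _ := Nat.cast_le.2 (hB₂ hs₂)
        linarith [hnn (Q'.filter fun z => (z.1, z.2.1 + 1, z.2.2 - 1) ∉ Q')]
      · have e1 : (N : ℝ) ≤ _ := Nat.cast_le.2 (hB₁ hs₁)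
        have e3 : (N : ℝ) ≤ _ := Nat.cast_le.2 (hB₃ hs₃)
        linarith [hnn (Q'.filter fun z => (z.1, z.2.1, z.2.2 + 1) ∉ Q')]
      · have e2 : (N : ℝ) ≤ _ := Nat.cast_le.2 (hB₂ hs₂)
        have e3 : (N : ℝ) ≤ _ := Nat.cast_le.2 (hB₃ hs₃)
        linarith [hnn (Q'.filter fun z => (z.1, z.2.1 + 1, z.2.2) ∉ Q')]
  /- ### 8. Assemble -/
  have hNT : (Ta.card : ℝ) + Tb.card = (N : ℝ) := by
    rw [hN, hTa'card, hTb'card]; push_cast; ring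
  show ((((P ×ˢ Q).filter fun pq => dist pq.1 pq.2 = 1).card : ℕ) : ℝ) ≤
    contactDeficiency Q + 1020 * Real.pi * ρ
  rw [hNT] at hcross
  linarith [hcross, hmain]

end Summit.Ventures.Crystal3D.Theorems

end
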